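import Mathlib.NumberTheory.ArithmeticFunction.VonMangoldt
import Literature.NumberTheory.LFunctions.RiemannSiegelThetaBounds
import HarnessLib

/-!
# The deterministic zone of the truncated Weil density (`stub_highZone`)

Stub `stub_highZone` of the line `Sketch` for the crux `WindowStep` (stmt-RiemannHypothesis-14659,
route `SpectralTrace`; skeleton
`Summit.RiemannHypothesis.RiemannHypothesis.Cruxes.WindowStep.Sketch`).

**Statement.** Let `θ' = riemannSiegelThetaDeriv` (`θ'(t) = Re ψ(1/4 + it/2)/2 − (log π)/2`) and,
for a finite set `S ⊆ ℕ`, put `M = Σ_{m ∈ S} Λ(m)/√m`. If `|t| ≥ 2π · e^{2M + 2}` then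
`Σ_{m ∈ S} Λ(m) m^{-1/2} cos(t log m) < θ'(t)`,
i.e. the truncated spectral density `θ'(t)/π − (1/π) Σ_{m ∈ S} Λ(m) m^{-1/2} cos(t log m)` is
positive above the deterministic height `T_det(S) = 2π e^{2M+2}` (zone (iii) of the
resonance-anatomy card: nothing about zeros is needed there).

**Proof.** `M ≥ 0` termwise (`Λ ≥ 0`, `√m ≥ 0`; at `m = 0` both vanish and the quotient is `0`).
`θ'` is even (`riemannSiegelThetaDeriv_neg_holds`), so `θ'(t) = θ'(|t|)`; with `u = |t| ≥ 2π e² > 6`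
the explicit Stirling bound `|θ'(u) − ½ log(u/2π)| ≤ 2/u` (`abs_riemannSiegelThetaDeriv_sub_log_le`)
gives `θ'(u) ≥ ½ log(u/2π) − 2/u ≥ (M + 1) − 2/u > M`, because `u/(2π) ≥ e^{2M+2}` and `2/u < 1`.
Finally `Σ Λ(m) m^{-1/2} cos(t log m) ≤ M` since `cos ≤ 1` and the weights are nonnegative.
Elementary; all ingredients are proved tree facts. [folklore]
-/

-- D-0017: `Summit.<S>.<S>.…` is the designed namespace of a single-problem summit; the lakefile turns
-- this linter off for `Summits`, repeated here so that standalone elaboration is warning-free too.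
set_option linter.dupNamespace false

noncomputable section

open scoped Real

namespace Summit.RiemannHypothesis.RiemannHypothesis.Theorems.SpectralTraceWindowStep

open Literature.NumberTheory.LFunctions

/-- The prime-power weight `Λ(m)/√m` is nonnegative (`Λ ≥ 0`, `√m ≥ 0`). [folklore] -/
theorem stub_highZone_weight_nonneg (m : ℕ) :
    0 ≤ (ArithmeticFunction.vonMangoldt m : ℝ) / Real.sqrt m :=
  div_nonneg ArithmeticFunction.vonMangoldt_nonneg (Real.sqrt_nonneg _)

/-- The cosine sum is at most the total weight `M = Σ_{m ∈ S} Λ(m)/√m` (`cos ≤ 1`, nonnegative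
weights). [folklore] -/
theorem stub_highZone_sum_le (S : Finset ℕ) (t : ℝ) :
    ∑ m ∈ S, (ArithmeticFunction.vonMangoldt m : ℝ) / Real.sqrt m * Real.cos (t * Real.log m) ≤
      ∑ m ∈ S, (ArithmeticFunction.vonMangoldt m : ℝ) / Real.sqrt m :=
  Finset.sum_le_sum fun m _ ↦
    mul_le_of_le_one_right (stub_highZone_weight_nonneg m) (Real.cos_le_one _)

/-- `θ'` is even, so `θ'(|t|) = θ'(t)` (`riemannSiegelThetaDeriv_neg_holds`). [folklore] -/
theorem stub_highZone_thetaDeriv_abs (t : ℝ) :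
    riemannSiegelThetaDeriv |t| = riemannSiegelThetaDeriv t := by
  rcases le_or_gt 0 t with ht | ht
  · rw [abs_of_nonneg ht]
  · rw [abs_of_neg ht, riemannSiegelThetaDeriv_neg_holds t]

/-- The high-zone lower bound for `θ'`: if `0 ≤ M` and `2π e^{2M+2} ≤ u` then `M < θ'(u)`.
From `|θ'(u) − ½ log(u/2π)| ≤ 2/u` (`abs_riemannSiegelThetaDeriv_sub_log_le`, `u ≥ 1`),
`½ log(u/2π) ≥ M + 1` and `2/u < 1` (`u > 6`). [folklore] -/
theorem stub_highZone_lt_thetaDeriv {M u : ℝ} (hM : 0 ≤ M)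
    (hu : 2 * Real.pi * Real.exp (2 * M + 2) ≤ u) : M < riemannSiegelThetaDeriv u := by
  have hπ : 3 < π := Real.pi_gt_three
  have h2π : 0 < 2 * π := by positivity
  have hexp1 : 1 ≤ Real.exp (2 * M + 2) := Real.one_le_exp (by linarith)
  have hexp_pos : 0 < Real.exp (2 * M + 2) := Real.exp_pos _
  have h6 : 6 < 2 * π * Real.exp (2 * M + 2) := by
    have h := mul_le_mul_of_nonneg_left hexp1 h2π.le
    linarith
  have hu6 : 6 < u := lt_of_lt_of_le h6 hu
  have hu0 : 0 < u := by linarith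
  have hu1 : 1 ≤ u := by linarith
  -- the explicit Stirling bound, lower half
  have hb := (abs_le.1 (abs_riemannSiegelThetaDeriv_sub_log_le hu1)).1
  -- `½ log(u/2π) ≥ M + 1`
  have hlog : 2 * M + 2 ≤ Real.log (u / (2 * π)) := by
    have h1 : Real.exp (2 * M + 2) ≤ u / (2 * π) := by
      rw [le_div_iff₀ h2π]
      calc Real.exp (2 * M + 2) * (2 * π) = 2 * π * Real.exp (2 * M + 2) := by ring
        _ ≤ u := hu
    have h2 := Real.log_le_log hexp_pos h1
    rwa [Real.log_exp] at h2
  -- `2/u < 1`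
  have h2u : 2 / u < 1 := by
    rw [div_lt_one hu0]
    linarith
  linarith

/-- **stub_highZone — the deterministic zone (line `Sketch`, crux `WindowStep`).** For a finite set
`S ⊆ ℕ` put `M = Σ_{m∈S} Λ(m)/√m`; if `|t| ≥ 2π e^{2M+2}` then
`Σ_{m∈S} Λ(m) m^{-1/2} cos(t log m) < θ'(t)`: `θ'` is even (`riemannSiegelThetaDeriv_neg_holds`),
`|θ'(u) − ½ log(u/2π)| ≤ 2/u` for `u ≥ 1` (`abs_riemannSiegelThetaDeriv_sub_log_le`),
`½ log(|t|/2π) ≥ M + 1`, `2/|t| < 1`, and the cosine sum is at most `M` (`Λ ≥ 0`, `cos ≤ 1`).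
This is `T_det` of the resonance-anatomy card. [folklore] -/
theorem stub_highZone :
    ∀ (S : Finset ℕ) (t : ℝ),
      2 * Real.pi * Real.exp (2 * (∑ m ∈ S, (ArithmeticFunction.vonMangoldt m : ℝ) / Real.sqrt m) + 2) ≤ |t| →
        ∑ m ∈ S, (ArithmeticFunction.vonMangoldt m : ℝ) / Real.sqrt m * Real.cos (t * Real.log m) <
          Literature.NumberTheory.LFunctions.riemannSiegelThetaDeriv t := by
  intro S t ht
  have hM : 0 ≤ ∑ m ∈ S, (ArithmeticFunction.vonMangoldt m : ℝ) / Real.sqrt m :=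
    Finset.sum_nonneg fun m _ ↦ stub_highZone_weight_nonneg m
  have h := stub_highZone_lt_thetaDeriv hM ht
  rw [stub_highZone_thetaDeriv_abs] at h
  exact (stub_highZone_sum_le S t).trans_lt h

end Summit.RiemannHypothesis.RiemannHypothesis.Theorems.SpectralTraceWindowStep
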